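import Mathlib
import Literature.MathematicalPhysics.QuantumLattice.HubbardBandSectorCountingToolbox
import HarnessLib

/-!
# Route `KLProgramme` — crux K3 `KLRegimeTwoPointLimit` (stmt-HubbardSuperconductivity-19937), support:
# the one-dimensional shell-measure lemma (DECOMP App. E Lemmas E.1 / E.3, step "transversality ⇒ measure")

Cell `gate-hubbard-kl`, seat p1b (C1 second hand); paper note `HOME/prover-p1b/E1-NOTE.md` §3 Lemma 5.

After the tube reduction, the two-shell (particle–particle / particle–hole) phase-space bound of
Lemmas E.1/E.3 is a bound on the Lebesgue measure of the sublevel set `{θ : |G_w(θ)| ≤ δ}` of the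
level function `G_w(θ) = ε(p_μ(θ) - w) - μ` of the translated band Fermi curve, and the companion
file `KLProgrammeKLRegimeTwoPointLimitShellTransversality.lean` supplies the pointwise slope bound
`|G_w'| ≥ Λ` on that set. This file is the abstract real-variable step turning the slope bound into a
measure bound, with the number of zeros as the only global input:

* `klsm_exists_center_near` — **descent**: if `|g'| ≥ Λ > 0` at every point of `[x, y]` where
  `|g| ≤ δ`, then every such point lies within `δ/Λ` of a zero of `g` in `[x, y]` or of an endpoint
  (follow `g` downhill: it decreases at rate `≥ Λ` while `|g| ≤ δ`, so it vanishes within `δ/Λ`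
  unless the interval ends first; an interior minimum with `0 < g ≤ δ` is excluded by `g' ≠ 0`);
* `klsm_sublevel_subset_iUnion` — hence `{z ∈ [x,y] : |g z| ≤ δ} ⊆ ⋃_{c ∈ Z ∪ {x,y}} [c - δ/Λ, c + δ/Λ]`
  for any finite set `Z` containing the zeros;
* `klsm_volume_sublevel_le` — **the shell-measure lemma**:
  `vol{z ∈ [x,y] : |g z| ≤ δ} ≤ (#Z + 2)·(2δ/Λ)`.

Pure Mathlib real analysis (mean value theorem in the form of the tree's
`BandSectorCounting.mul_sub_le_abs_sub_of_le_abs_deriv`, the intermediate value theorem, Fermat's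
stationary-point theorem); no hypothesis on `g` beyond differentiability everywhere.

What is deliberately NOT here: the zero count for the translated Fermi curve (E1-NOTE Lemma 7), the
second-order (caustic) version, the area assembly.
-/

noncomputable section

-- the tree's namespace `Summit.<Summit>.<Problem>.Theorems` repeats the summit name by design (D-0017)
set_option linter.dupNamespace false

open Real Set MeasureTheory
open scoped ENNReal
open Literature.MathematicalPhysics.QuantumLattice.BandSectorCounting

namespace Summit.HubbardSuperconductivity.HubbardSuperconductivity.Theorems

/-! ### Descent to a zero -/

/-- Descent, positive case: if `|g'| ≥ Λ > 0` wherever `|g| ≤ δ` on `[x, y]`, a point `z ∈ [x, y]`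
with `0 < g z ≤ δ` is within `δ/Λ` of a zero of `g` in `[x, y]` or of an endpoint of `[x, y]`. -/
theorem klsm_exists_center_near_of_pos {g g' : ℝ → ℝ} (hg : ∀ t, HasDerivAt g (g' t) t)
    {x y δ Λ z : ℝ} (hΛ : 0 < Λ)
    (htrans : ∀ t ∈ Icc x y, |g t| ≤ δ → Λ ≤ |g' t|)
    (hz : z ∈ Icc x y) (hgz : 0 < g z) (hgzδ : g z ≤ δ) :
    ∃ c : ℝ, ((c ∈ Icc x y ∧ g c = 0) ∨ c = x ∨ c = y) ∧ |z - c| ≤ δ / Λ := by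
  have hcont : Continuous g := continuous_iff_continuousAt.2 fun t => (hg t).continuousAt
  by_contra H
  push Not at H
  set r := δ / Λ with hr
  have hδ : 0 < δ := hgz.trans_le hgzδ
  have hrpos : 0 < r := div_pos hδ hΛ
  have hΛr : Λ * r = δ := by rw [hr]; field_simp
  -- the endpoints are far: `[z - r, z + r] ⊆ (x, y)`
  have hxz : x < z - r := by
    have h := H x (Or.inr (Or.inl rfl))
    rw [abs_of_nonneg (by linarith [hz.1])] at h; linarith
  have hzy : z + r < y := by
    have h := H y (Or.inr (Or.inr rfl))
    rw [abs_of_nonpos (by linarith [hz.2])] at h; linarith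
  have hsub : ∀ t ∈ Icc (z - r) (z + r), t ∈ Icc x y := fun t ht => ⟨by linarith [ht.1], by linarith [ht.2]⟩
  -- no zero of `g` on `[z - r, z + r]`
  have hnoz : ∀ t ∈ Icc (z - r) (z + r), g t ≠ 0 := by
    intro t ht h0
    have h := H t (Or.inl ⟨hsub t ht, h0⟩)
    have : |z - t| ≤ r := by rw [abs_le]; constructor <;> linarith [ht.1, ht.2]
    linarith
  -- hence `g > 0` there (intermediate value theorem from `z`)
  have hpos : ∀ t ∈ Icc (z - r) (z + r), 0 < g t := by
    intro t ht
    by_contra hle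
    push Not at hle
    rcases le_total t z with htz | hzt
    · have hivt := intermediate_value_Icc htz hcont.continuousOn
      obtain ⟨c, hc, hc0⟩ := hivt ⟨hle, hgz.le⟩
      exact hnoz c ⟨le_trans ht.1 hc.1, by linarith [hc.2]⟩ hc0
    · have hivt := intermediate_value_Icc' hzt hcont.continuousOn
      obtain ⟨c, hc, hc0⟩ := hivt ⟨hle, hgz.le⟩
      exact hnoz c ⟨by linarith [hc.1], le_trans hc.2 ht.2⟩ hc0
  -- LEFT: either `g ≤ δ` on `[z - r, z]` (then the slope bound forces a zero) or `g > δ` somewhere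
  have hleft : ∃ t ∈ Icc (z - r) z, δ < g t := by
    by_contra hA
    push Not at hA
    have hder : ∀ t ∈ Icc (z - r) z, Λ ≤ |g' t| := by
      intro t ht
      have ht' : t ∈ Icc (z - r) (z + r) := ⟨ht.1, by linarith [ht.2]⟩
      refine htrans t (hsub t ht') ?_
      rw [abs_of_pos (hpos t ht')]; exact hA t ht
    have hmvt := mul_sub_le_abs_sub_of_le_abs_deriv hg (by linarith : z - r ≤ z) hΛ hder
    rw [show z - (z - r) = r by ring, hΛr] at hmvt
    have h1 := hpos (z - r) ⟨le_rfl, by linarith⟩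
    have h2 := hA (z - r) ⟨le_rfl, by linarith⟩
    have h3 : |g z - g (z - r)| < δ := by rw [abs_sub_lt_iff]; constructor <;> linarith
    linarith
  -- RIGHT: symmetric
  have hright : ∃ t ∈ Icc z (z + r), δ < g t := by
    by_contra hA
    push Not at hA
    have hder : ∀ t ∈ Icc z (z + r), Λ ≤ |g' t| := by
      intro t ht
      have ht' : t ∈ Icc (z - r) (z + r) := ⟨by linarith [ht.1], ht.2⟩
      refine htrans t (hsub t ht') ?_
      rw [abs_of_pos (hpos t ht')]; exact hA t ht
    have hmvt := mul_sub_le_abs_sub_of_le_abs_deriv hg (by linarith : z ≤ z + r) hΛ hder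
    rw [show z + r - z = r by ring, hΛr] at hmvt
    have h1 := hpos (z + r) ⟨by linarith, le_rfl⟩
    have h2 := hA (z + r) ⟨by linarith, le_rfl⟩
    have h3 : |g (z + r) - g z| < δ := by rw [abs_sub_lt_iff]; constructor <;> linarith
    linarith
  -- an interior minimum of `g` on `[t, t']` with `0 < g ≤ δ` and `g' = 0`: contradiction
  obtain ⟨t, ht, hgt⟩ := hleft
  obtain ⟨t', ht', hgt'⟩ := hright
  have htt' : t ≤ t' := le_trans ht.2 ht'.1
  obtain ⟨c, hc, hmin⟩ := isCompact_Icc.exists_isMinOn (nonempty_Icc.2 htt') hcont.continuousOn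
  have hcz : g c ≤ g z := hmin ⟨ht.2, ht'.1⟩
  have hct : c ≠ t := fun h => by rw [h] at hcz; linarith
  have hct' : c ≠ t' := fun h => by rw [h] at hcz; linarith
  have hc1 : t < c := lt_of_le_of_ne hc.1 (Ne.symm hct)
  have hc2 : c < t' := lt_of_le_of_ne hc.2 hct'
  have hloc : IsLocalMin g c := hmin.isLocalMin (Icc_mem_nhds hc1 hc2)
  have hzero : g' c = 0 := hloc.hasDerivAt_eq_zero (hg c)
  have hcI : c ∈ Icc (z - r) (z + r) := ⟨by linarith [ht.1], by linarith [ht'.2]⟩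
  have hgc : |g c| ≤ δ := by rw [abs_of_pos (hpos c hcI)]; linarith
  have := htrans c (hsub c hcI) hgc
  rw [hzero, abs_zero] at this
  linarith

/-- **Descent.** If `|g'| ≥ Λ > 0` wherever `|g| ≤ δ` on `[x, y]`, every point `z ∈ [x, y]` with
`|g z| ≤ δ` is within `δ/Λ` of a zero of `g` in `[x, y]` or of an endpoint of `[x, y]`. -/
theorem klsm_exists_center_near {g g' : ℝ → ℝ} (hg : ∀ t, HasDerivAt g (g' t) t)
    {x y δ Λ z : ℝ} (hΛ : 0 < Λ)
    (htrans : ∀ t ∈ Icc x y, |g t| ≤ δ → Λ ≤ |g' t|)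
    (hz : z ∈ Icc x y) (hgz : |g z| ≤ δ) :
    ∃ c : ℝ, ((c ∈ Icc x y ∧ g c = 0) ∨ c = x ∨ c = y) ∧ |z - c| ≤ δ / Λ := by
  have hδ : 0 ≤ δ := (abs_nonneg _).trans hgz
  rcases lt_trichotomy (g z) 0 with hneg | h0 | hposz
  · -- apply the positive case to `-g`
    have hng : ∀ t, HasDerivAt (fun s => -g s) (-g' t) t := fun t => (hg t).neg
    have htrans' : ∀ t ∈ Icc x y, |(fun s => -g s) t| ≤ δ → Λ ≤ |(-g' t)| := by
      intro t ht h; rw [abs_neg] at h ⊢; exact htrans t ht h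
    obtain ⟨c, hc, hcz⟩ := klsm_exists_center_near_of_pos hng hΛ htrans' hz
      (by show 0 < -g z; linarith) (by show -g z ≤ δ; rw [abs_of_neg hneg] at hgz; linarith)
    refine ⟨c, ?_, hcz⟩
    rcases hc with ⟨hc1, hc2⟩ | hc
    · exact Or.inl ⟨hc1, by simpa using hc2⟩
    · exact Or.inr hc
  · exact ⟨z, Or.inl ⟨hz, h0⟩, by rw [sub_self, abs_zero]; exact div_nonneg hδ hΛ.le⟩
  · exact klsm_exists_center_near_of_pos hg hΛ htrans hz hposz (by rw [abs_of_pos hposz] at hgz; exact hgz)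

/-! ### Covering and measure -/

/-- **Covering.** Under the slope hypothesis, the sublevel set `{z ∈ [x,y] : |g z| ≤ δ}` is covered
by the intervals of radius `δ/Λ` around the points of any finite set `Z` containing the zeros of `g`
in `[x, y]`, together with those around the two endpoints. -/
theorem klsm_sublevel_subset_iUnion {g g' : ℝ → ℝ} (hg : ∀ t, HasDerivAt g (g' t) t)
    {x y δ Λ : ℝ} (hΛ : 0 < Λ)
    (htrans : ∀ t ∈ Icc x y, |g t| ≤ δ → Λ ≤ |g' t|)
    (Z : Finset ℝ) (hZ : ∀ c ∈ Icc x y, g c = 0 → c ∈ Z) :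
    {z ∈ Icc x y | |g z| ≤ δ} ⊆
      ⋃ c ∈ insert x (insert y Z), Icc (c - δ / Λ) (c + δ / Λ) := by
  intro z hz
  obtain ⟨c, hc, hcz⟩ := klsm_exists_center_near hg hΛ htrans hz.1 hz.2
  have hcmem : c ∈ insert x (insert y Z) := by
    rcases hc with ⟨hc1, hc2⟩ | rfl | rfl
    · exact Finset.mem_insert_of_mem (Finset.mem_insert_of_mem (hZ c hc1 hc2))
    · exact Finset.mem_insert_self _ _
    · exact Finset.mem_insert_of_mem (Finset.mem_insert_self _ _)
  simp only [mem_iUnion, mem_Icc, exists_prop]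
  refine ⟨c, hcmem, ?_, ?_⟩
  · have := (abs_le.1 hcz).1; linarith
  · have := (abs_le.1 hcz).2; linarith

/-- **The one-dimensional shell-measure lemma.** If `g` is differentiable on `ℝ` and `|g'| ≥ Λ > 0`
at every point of `[x, y]` where `|g| ≤ δ`, then for any finite set `Z` containing the zeros of `g`
in `[x, y]`,
`vol {z ∈ [x, y] : |g z| ≤ δ} ≤ (#Z + 2) · (2δ/Λ)`.
(E1-NOTE Lemma 5; applied with `g = G_w`, `Λ` from `klst_slope_lower_bound`, `#Z ≤ N₀`.) -/
theorem klsm_volume_sublevel_le {g g' : ℝ → ℝ} (hg : ∀ t, HasDerivAt g (g' t) t)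
    {x y δ Λ : ℝ} (hΛ : 0 < Λ)
    (htrans : ∀ t ∈ Icc x y, |g t| ≤ δ → Λ ≤ |g' t|)
    (Z : Finset ℝ) (hZ : ∀ c ∈ Icc x y, g c = 0 → c ∈ Z) :
    volume {z ∈ Icc x y | |g z| ≤ δ} ≤ ((Z.card : ℝ≥0∞) + 2) * ENNReal.ofReal (2 * δ / Λ) := by
  have hcover := klsm_sublevel_subset_iUnion hg hΛ htrans Z hZ
  refine (measure_mono hcover).trans ?_
  refine (measure_biUnion_finset_le _ _).trans ?_
  have hvol : ∀ c : ℝ, volume (Icc (c - δ / Λ) (c + δ / Λ)) = ENNReal.ofReal (2 * δ / Λ) := by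
    intro c; rw [Real.volume_Icc]; congr 1; ring
  simp only [hvol, Finset.sum_const, nsmul_eq_mul]
  gcongr
  have hcard : (insert x (insert y Z)).card ≤ Z.card + 2 := by
    calc (insert x (insert y Z)).card ≤ (insert y Z).card + 1 := Finset.card_insert_le _ _
      _ ≤ Z.card + 1 + 1 := by gcongr; exact Finset.card_insert_le _ _
      _ = Z.card + 2 := by ring
  exact_mod_cast hcard

end Summit.HubbardSuperconductivity.HubbardSuperconductivity.Theorems

end
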